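import Mathlib
import HarnessLib
import Summits.HubbardSuperconductivity.HubbardSuperconductivity.Theorems.KLProgrammeKLRegimeTorusL1ProductBump
import Summits.HubbardSuperconductivity.HubbardSuperconductivity.Theorems.KLProgrammeKLRegimeEnginePlainLineFromMomentumRepresentation

/-!
# Route `KLProgramme` — engine support (row (X).1 / #14 «S3 IN U-CURRENCY», NORM side, brick (T8)): the one-call (T7) instantiated with the CANONICAL PRODUCT
# BUMPS of (T4) — the plain four-leg line from «amplitudes × canonical conserving transfer bumps + remainder», with every rate discharged

Cell gate-hubbard-kl, seat hubbard-kl-k3c2-p3 (g16).  (T7) `plainFourLegLine_of_momentumRepresentation` takes abstract (T1)-bump data per term; (T4) proves those data for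
the canonical product bumps `G_R(q) = φ(q̃₁/R₀)·φ((q̃₂)₀/R₁)·φ((q̃₂)₁/R₁)` but concludes the `ℓ¹` bound directly.  Here the two are joined:

* §1 `sampledBump_neg`, **`productBump_neg`** — for an EVEN profile `φ` the canonical bump is even in `q` (so the `G(−Q)` convention of (T5b)/(T7) is immaterial);
* §2 **`productBump_rateData`** — the (T1)/(T7) hypothesis package for `G_R` with EXPLICIT rates `s₀ = 4R₀/(√K·P)`, `s₁ = 4R₁/(√K·L)`, `A = 1`, `n₀ = K√K`,
  `N_s = 64R₀R₁²` (`K ≥ 1`, `4R₀ ≤ P`, `2R₀+4 ≤ P`, `4R₁ ≤ L`, `2R₁+4 ≤ L`);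
* §3 **`plainFourLegLine_of_productBumpRepresentation`** — for ANY `𝒱`, spins `σ`, charges `(+,+,−,−)`: if
  `kernel ℂ 𝒱 4 ((k_i,σ_i),c_i) = Σ_{i∈S} a_i·κ·[k̄₀+k̄₁ = k̄₂+k̄₃]·G_{R(i)}(k̄₀+k̄₁) + ρ(k)` with radii `R₀(i), R₁(i)` admissible at every `i ∈ S` and the remainder's
  plane-wave transform has plain line `≤ r`, then
  `fixedTupleL1 L M β 3 (sectorisedKernel … trivialMultiplier 𝒱 4) Ω y ≤ ε_x³·(‖κ‖(2M·L²)²)·√(10485760·K√K)·(2M·L²)·Σ_{i∈S}‖a_i‖ + r`.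
With the model normalisation `ε_x³·‖κ‖·(2M·L²)³ = |λ|/24` this is `(|λ|/24)·√(10485760·K√K)·Σ‖a_i‖ + r` — U-currency as soon as `Σ‖a_i‖` is ((s2), child 1 row 7).
Everything is proved; no definitions, no named facts; `hker`/`hr` asserted for no engine object; nothing asserts (X).1, (b), any stub, K3 or superconductivity. [folklore]
References: Katznelson Ch. I §6.3; BGM 2006 §2.3 (2.17), §3 (3.65) [cite: BenfattoGiulianiMastropietro2006].
-/

noncomputable section

namespace Summit.HubbardSuperconductivity.HubbardSuperconductivity.Theorems.TorusFourierL2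

set_option linter.dupNamespace false -- summit = problem name (single-conjunct summit), D-0017

open Finset Complex Literature.Probability.LatticeModels Literature.MathematicalPhysics.QuantumLattice
open Literature.MathematicalPhysics.QuantumLattice.GrassmannAlgebra
open Summit.HubbardSuperconductivity.HubbardSuperconductivity.Theorems.KLRegimeSplit
open scoped Real ComplexConjugate

/-! ### §1 Evenness of the canonical bumps -/

/-- A sampled EVEN profile is even on `ℤ/n`: `φ((−a)~/R) = φ(ã/R)`. [folklore] -/
theorem sampledBump_neg {n : ℕ} [NeZero n] (φ : ℝ → ℝ) (hφe : ∀ t, φ (-t) = φ t) (R : ℝ) (a : ZMod n) :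
    φ (((-a).valMinAbs : ℝ) / R) = φ ((a.valMinAbs : ℝ) / R) := by
  by_cases h : 2 * a.val = n
  · rw [(ZMod.neg_eq_self_iff a).2 (Or.inr h)]
  · rw [ZMod.valMinAbs_neg_of_ne_half h, Int.cast_neg, neg_div, hφe]

/-- **The canonical product bump is even in `q`** (for an even profile). [folklore] -/
theorem productBump_neg {P L : ℕ} [NeZero P] [NeZero L] (φ : ℝ → ℝ) (hφe : ∀ t, φ (-t) = φ t) (R₀ R₁ : ℝ) (q : TorusSite 1 P × TorusSite 2 L) :
    φ ((((-q).1 0).valMinAbs : ℝ) / R₀) * (φ ((((-q).2 0).valMinAbs : ℝ) / R₁) * φ ((((-q).2 1).valMinAbs : ℝ) / R₁)) =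
      φ (((q.1 0).valMinAbs : ℝ) / R₀) * (φ (((q.2 0).valMinAbs : ℝ) / R₁) * φ (((q.2 1).valMinAbs : ℝ) / R₁)) := by
  simp only [Prod.fst_neg, Prod.snd_neg, Pi.neg_apply, sampledBump_neg φ hφe]

/-! ### §2 The (T1)/(T7) hypothesis package of a canonical bump, with explicit rates -/

/-- **Rate data of the canonical product bump**: with `s₀ = 4R₀/(√K·P)`, `s₁ = 4R₁/(√K·L)` — `0 < s₀ ≤ 1`, `0 < s₁ ≤ 1`, `64R₀R₁² ≤ (K√K)(s₀P)(s₁L)²`,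
`#supp ≤ 64R₀R₁²`, `‖G‖ ≤ 1`, time/axis second differences `≤ 1·(4/(s₀P))²`, `≤ 1·(4/(s₁L))²`. [cite: Katznelson2004, Ch. I §6.3] -/
theorem productBump_rateData {P L : ℕ} [NeZero P] [NeZero L] (φ : ℝ → ℝ) (hφ : ContDiff ℝ 2 φ) {K : ℝ} (hK1 : 1 ≤ K)
    (hK : ∀ t, |iteratedDeriv 2 φ t| ≤ K) (hφ1 : ∀ t, |φ t| ≤ 1) (hφ0 : ∀ t, 1 ≤ |t| → φ t = 0)
    {R₀ R₁ : ℕ} (hR₀ : 0 < R₀) (hR₁ : 0 < R₁) (hP : 4 * R₀ ≤ P) (hL : 4 * R₁ ≤ L) (hP' : 2 * R₀ + 4 ≤ P) (hL' : 2 * R₁ + 4 ≤ L) :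
    let G : TorusSite 1 P × TorusSite 2 L → ℂ := fun q =>
      ((φ (((q.1 0).valMinAbs : ℝ) / R₀) * (φ (((q.2 0).valMinAbs : ℝ) / R₁) * φ (((q.2 1).valMinAbs : ℝ) / R₁)) : ℝ) : ℂ)
    let s₀ : ℝ := 4 * R₀ / (Real.sqrt K * P)
    let s₁ : ℝ := 4 * R₁ / (Real.sqrt K * L)
    0 < s₀ ∧ s₀ ≤ 1 ∧ 0 < s₁ ∧ s₁ ≤ 1 ∧ (((64 * R₀ * R₁ ^ 2 : ℕ) : ℝ) ≤ (K * Real.sqrt K) * (s₀ * P) * (s₁ * L) ^ 2) ∧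
    ((univ.filter fun q => G q ≠ 0).card ≤ 64 * R₀ * R₁ ^ 2) ∧ (∀ q, ‖G q‖ ≤ 1) ∧
    (∀ q, ‖(fwdDiff ((fun _ : Fin 1 => (1 : ZMod P)), (0 : TorusSite 2 L)))^[2] G q‖ ≤ 1 * (4 / (s₀ * P)) ^ 2) ∧
    (∀ q (i : Fin 2), ‖(fwdDiff ((0 : TorusSite 1 P), (Pi.single i (1 : ZMod L) : TorusSite 2 L)))^[2] G q‖ ≤ 1 * (4 / (s₁ * L)) ^ 2) := by
  intro G s₀ s₁
  obtain ⟨hsup, hsupp, h₀, h₁⟩ := productBump_bumpData (P := P) (L := L) φ hφ hK hφ1 hφ0 hR₀ hR₁ hP' hL'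
  have hK0 : 0 < K := lt_of_lt_of_le one_pos hK1
  have hsK : 0 < Real.sqrt K := Real.sqrt_pos.2 hK0
  have hsK1 : 1 ≤ Real.sqrt K := by rw [← Real.sqrt_one]; exact Real.sqrt_le_sqrt hK1
  have hsKsq : Real.sqrt K ^ 2 = K := Real.sq_sqrt hK0.le
  have hPpos : (0 : ℝ) < P := by exact_mod_cast lt_of_lt_of_le (by omega : 0 < 4 * R₀) hP
  have hLpos : (0 : ℝ) < L := by exact_mod_cast lt_of_lt_of_le (by omega : 0 < 4 * R₁) hL
  have hR₀' : (0 : ℝ) < R₀ := by exact_mod_cast hR₀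
  have hR₁' : (0 : ℝ) < R₁ := by exact_mod_cast hR₁
  have hs₀pos : 0 < s₀ := by positivity
  have hs₁pos : 0 < s₁ := by positivity
  have hs₀1 : s₀ ≤ 1 := by
    show 4 * (R₀ : ℝ) / (Real.sqrt K * P) ≤ 1
    rw [div_le_one (by positivity)]
    have : (4 * R₀ : ℝ) ≤ P := by exact_mod_cast hP
    nlinarith
  have hs₁1 : s₁ ≤ 1 := by
    show 4 * (R₁ : ℝ) / (Real.sqrt K * L) ≤ 1
    rw [div_le_one (by positivity)]
    have : (4 * R₁ : ℝ) ≤ L := by exact_mod_cast hL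
    nlinarith
  have hs₀P : s₀ * P = 4 * R₀ / Real.sqrt K := by
    show 4 * (R₀ : ℝ) / (Real.sqrt K * P) * P = _; field_simp
  have hs₁L : s₁ * L = 4 * R₁ / Real.sqrt K := by
    show 4 * (R₁ : ℝ) / (Real.sqrt K * L) * L = _; field_simp
  have h4₀ : 4 / (s₀ * P) = Real.sqrt K / R₀ := by
    rw [hs₀P, div_div_eq_mul_div, div_eq_div_iff (by positivity) hR₀'.ne']; ring
  have h4₁ : 4 / (s₁ * L) = Real.sqrt K / R₁ := by
    rw [hs₁L, div_div_eq_mul_div, div_eq_div_iff (by positivity) hR₁'.ne']; ring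
  have hrate₀ : K / (R₀ : ℝ) ^ 2 = 1 * (4 / (s₀ * P)) ^ 2 := by rw [h4₀, div_pow, hsKsq, one_mul]
  have hrate₁ : K / (R₁ : ℝ) ^ 2 = 1 * (4 / (s₁ * L)) ^ 2 := by rw [h4₁, div_pow, hsKsq, one_mul]
  have hNs : ((64 * R₀ * R₁ ^ 2 : ℕ) : ℝ) ≤ (K * Real.sqrt K) * (s₀ * P) * (s₁ * L) ^ 2 := by
    rw [hs₀P, hs₁L, div_pow, hsKsq]
    have hKK : (K * Real.sqrt K) * (4 * (R₀ : ℝ) / Real.sqrt K) * ((4 * (R₁ : ℝ)) ^ 2 / K) = 64 * R₀ * R₁ ^ 2 := by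
      field_simp
      ring
    rw [hKK]; push_cast; exact le_rfl
  exact ⟨hs₀pos, hs₀1, hs₁pos, hs₁1, hNs, hsupp, hsup, fun q => (h₀ q).trans (le_of_eq hrate₀), fun q i => (h₁ q i).trans (le_of_eq hrate₁)⟩

/-! ### §3 The one-call with canonical bumps -/

variable {L M : ℕ} [NeZero L] [NeZero M]

/-- **PLAIN FOUR-LEG LINE FROM «AMPLITUDES × CANONICAL CONSERVING TRANSFER BUMPS + REMAINDER»** (see the module docstring): every rate discharged;
only the amplitudes `a_i`, the radii `R₀(i), R₁(i)` (admissible), the normalisation `κ` and the remainder's plain line `r` are the producer's.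
[cite: BenfattoGiulianiMastropietro2006, §3 (3.65)] -/
theorem plainFourLegLine_of_productBumpRepresentation {ι : Type*} {β : ℝ} (hβ : 0 < β) (𝒱 : HubbardGrassmann L M) (σ : Fin 4 → Fin 2)
    (φ : ℝ → ℝ) (hφ : ContDiff ℝ 2 φ) {K : ℝ} (hK1 : 1 ≤ K) (hK : ∀ t, |iteratedDeriv 2 φ t| ≤ K) (hφ1 : ∀ t, |φ t| ≤ 1)
    (hφ0 : ∀ t, 1 ≤ |t| → φ t = 0) (hφe : ∀ t, φ (-t) = φ t)
    (S : Finset ι) (a : ι → ℂ) (κ : ℂ) (R₀ R₁ : ι → ℕ) (ρ : (Fin 4 → FreqMomentum L M) → ℂ)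
    (hR₀ : ∀ i ∈ S, 0 < R₀ i) (hR₁ : ∀ i ∈ S, 0 < R₁ i) (hP : ∀ i ∈ S, 4 * R₀ i ≤ 2 * M) (hL : ∀ i ∈ S, 4 * R₁ i ≤ L)
    (hP' : ∀ i ∈ S, 2 * R₀ i + 4 ≤ 2 * M) (hL' : ∀ i ∈ S, 2 * R₁ i + 4 ≤ L)
    (hker : ∀ k : Fin 4 → FreqMomentum L M,
      kernel ℂ 𝒱 4 (fun i => ((k i, σ i), (![0, 0, 1, 1] : Fin 4 → Fin 2) i)) =
        ∑ i ∈ S, a i * (κ * (if ((fun _ : Fin 1 => (((k 0).1 : ℕ) : ZMod (2 * M))), (k 0).2) + ((fun _ : Fin 1 => (((k 1).1 : ℕ) : ZMod (2 * M))), (k 1).2) = (((fun _ : Fin 1 => (((k 2).1 : ℕ) : ZMod (2 * M))), (k 2).2) : TorusSite 1 (2 * M) × TorusSite 2 L) + ((fun _ : Fin 1 => (((k 3).1 : ℕ) : ZMod (2 * M))), (k 3).2) then (fun (i : ι) (q : TorusSite 1 (2 * M) × TorusSite 2 L) => (((φ ((((q).1 0).valMinAbs : ℝ) / ((R₀ i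 : ℝ))) * (φ ((((q).2 0).valMinAbs : ℝ) / ((R₁ i : ℝ))) * φ ((((q).2 1).valMinAbs : ℝ) / ((R₁ i : ℝ))))) : ℝ) : ℂ)) i (((fun _ : Fin 1 => (((k 0).1 : ℕ) : ZMod (2 * M))), (k 0).2) + ((fun _ : Fin 1 => (((k 1).1 : ℕ) : ZMod (2 * M))), (k 1).2)) else 0)) + ρ k)
    {r : ℝ}
    (hr : ∀ y : SpaceTimeIdx L M, fixedTupleL1 L M β 3
      (fun (Ω : Fin 4 → SectorLeg 1) (x : Fin 4 → SpaceTimeIdx L M) =>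
        ∑ k : Fin 4 → FreqMomentum L M, (∏ i, trivialMultiplier L M (Ω i).1.1 (k i) * hubbardPlaneWave L M β (Ω i).2 (k i) (x i)) * ρ k)
      (fun i : Fin 4 => ((((0 : Fin 1), σ i) : Fin 1 × Fin 2), (![0, 0, 1, 1] : Fin 4 → Fin 2) i)) y ≤ r)
    (y : SpaceTimeIdx L M) :
    fixedTupleL1 L M β 3 (sectorisedKernel L M β (trivialMultiplier L M) 𝒱 4) (fun i : Fin 4 => ((((0 : Fin 1), σ i) : Fin 1 × Fin 2), (![0, 0, 1, 1] : Fin 4 → Fin 2) i)) y ≤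
      imagTimeWeight β M ^ 3 * ((‖κ‖ * ((((2 * M : ℕ) : ℝ) * (L : ℝ) ^ 2) ^ 2)) *
        (Real.sqrt (10485760 * (K * Real.sqrt K)) * (((2 * M : ℕ) : ℝ) * (L : ℝ) ^ 2))) * ∑ i ∈ S, ‖a i‖ + r := by
  classical
  haveI : NeZero (2 * M) := ⟨by have := NeZero.ne M; omega⟩
  have hK0 : 0 < K := lt_of_lt_of_le one_pos hK1
  have hn₀ : 0 ≤ K * Real.sqrt K := by positivity
  -- the representation in (T7)'s `G(−Q)` form (evenness)
  have hker' : ∀ k : Fin 4 → FreqMomentum L M,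
      kernel ℂ 𝒱 4 (fun i => ((k i, σ i), (![0, 0, 1, 1] : Fin 4 → Fin 2) i)) =
        ∑ i ∈ S, a i * (κ * (if ((fun _ : Fin 1 => (((k 0).1 : ℕ) : ZMod (2 * M))), (k 0).2) + ((fun _ : Fin 1 => (((k 1).1 : ℕ) : ZMod (2 * M))), (k 1).2) = (((fun _ : Fin 1 => (((k 2).1 : ℕ) : ZMod (2 * M))), (k 2).2) : TorusSite 1 (2 * M) × TorusSite 2 L) + ((fun _ : Fin 1 => (((k 3).1 : ℕ) : ZMod (2 * M))), (k 3).2) then (fun Q => (fun (i : ι) (q : TorusSite 1 (2 * M) × TorusSite 2 L) => (((φ ((((q).1 0).valMinAbs : ℝ) / ((R₀ i : ℝ))) * (φ ((((q).2 0).valMinAbs : ℝ) / ((R₁ i : ℝ))) * φ ((((q).2 1).valMinAbs : ℝ) / ((R₁ i : ℝ))))) : ℝ) : ℂ)) i (-Q)) (((fun _ : Fin 1 => (((k 0).1 : ℕ) : ZMod (2 * M))), (k 0).2) + ((fun _ : Fin 1 => (((k 1).1 : ℕ) : ZMod (2 * M))), (k 1).2)) else 0)) + ρ k := by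
    intro k
    rw [hker k]
    congr 1
    refine sum_congr rfl fun i _ => ?_
    simp only [productBump_neg φ hφe]
  -- rate data per term
  have hD := fun i (hi : i ∈ S) => productBump_rateData (P := 2 * M) (L := L) φ hφ hK1 hK hφ1 hφ0 (hR₀ i hi) (hR₁ i hi) (hP i hi) (hL i hi) (hP' i hi) (hL' i hi)
  have h := plainFourLegLine_of_momentumRepresentation hβ 𝒱 σ S a κ (fun (i : ι) (q : TorusSite 1 (2 * M) × TorusSite 2 L) => (((φ ((((q).1 0).valMinAbs : ℝ) / ((R₀ i : ℝ))) * (φ ((((q).2 0).valMinAbs : ℝ) / ((R₁ i : ℝ))) * φ ((((q).2 1).valMinAbs : ℝ) / ((R₁ i : ℝ))))) : ℝ) : ℂ)) ρ hker'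
    (fun i => 4 * (R₀ i : ℝ) / (Real.sqrt K * ((2 * M : ℕ) : ℝ))) (fun i => 4 * (R₁ i : ℝ) / (Real.sqrt K * (L : ℝ))) (fun _ => (1 : ℝ))
    (fun i => 64 * R₀ i * R₁ i ^ 2) hn₀
    (fun i hi => (hD i hi).1) (fun i hi => (hD i hi).2.1) (fun i hi => (hD i hi).2.2.1) (fun i hi => (hD i hi).2.2.2.1)
    (fun _ _ => zero_le_one) (fun i hi => (hD i hi).2.2.2.2.1) (fun i hi => (hD i hi).2.2.2.2.2.1) (fun i hi => (hD i hi).2.2.2.2.2.2.1)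
    (fun i hi => (hD i hi).2.2.2.2.2.2.2.1) (fun i hi => (hD i hi).2.2.2.2.2.2.2.2) hr y
  simpa only [mul_one] using h

end Summit.HubbardSuperconductivity.HubbardSuperconductivity.Theorems.TorusFourierL2

end
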